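import Mathlib
import Summits.Ventures.HodgeRepro.Tier4.Common.AdelicDefs
import Summits.Ventures.HodgeRepro.Tier4.Common.MixedPlane
import Summits.Ventures.HodgeRepro.Tier4.Common.MixedPlaneKType
import Summits.Ventures.HodgeRepro.Tier4.Common.RowPlane
import Summits.Ventures.HodgeRepro.Tier4.Common.RowTorus
import Summits.Ventures.HodgeRepro.Tier4.Common.CongruenceAdeles
import Summits.Ventures.HodgeRepro.Tier4.Common.CompactOpenLevel
import Summits.Ventures.HodgeRepro.Tier4.Line4.LevelCosetCongruence
import Summits.Ventures.HodgeRepro.Tier4.Line4.BlockDetCongruence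

/-!
# Tier4/Line4/OrbitInvariant — the `T × T′`-invariant of a rational double coset (C-L4-ORBINV, lead (R-27)(a))

Blind re-derivation cell `pub-hodge-repro`, Tier 4 «prove the step» (README §9–§10), seat t4-L1-p3 (gen 4).
Tree path `lean/Summits/Ventures/HodgeRepro/Tier4/Line4/OrbitInvariant.lean`.

THE OBJECT.  On a row plane `U = ofLinesRow q a b ε` (`P i` = the block projectors, `Ω = blockDiag4 ω ω`) with its
second torus transported by an `E′`-linear invertible `g` (`Q i = g P i g'`, `PlaneData.withTransportedTorus` — the
shape of L4's `seesawPlane`), the `(0,0)` `E′`-entry of `γ` between the `P₀`-line and the `Q₀`-line is the top-left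
`2×2` block of `γ g` in the `P`-basis (it commutes with `ω`, so it is `x + y ω`), and the invariant is its NORM
`N_{E′/k}(x + y ω) = x² + t x y + n y² = det` of that block:

  `orbitInv W g γ := det (blockTL (GA.mat W γ * adMat k g))`.

WHAT IS PROVED.  (1) `orbitInv_torusT_mul`: left multiplication by `τ ∈ torusT W` does not change it (`τ` is
`blockDiag4R (x₀ + y₀ ω) (x₁ + y₁ ω)` with `N(x₀ + y₀ ω) = 1`, typer-2's `exists_block_of_mem_torusT_ofLinesRow`);
(2) `orbitInv_mul_torusT'`: right multiplication by `τ′ ∈ torusT′ W` does not change it — `σ := g' τ′ g` commutes with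
the `P i`, with `Ω`, and preserves the Gram matrix `B′` of the SOURCE plane `U′ = ofLinesRow q a' b' ε'` when `g` is a
similitude `g B′ gᵀ = λ B` (the skeleton's `IsSeesawIsometry`), so `σ ∈ torusT U′` and its top-left block has norm
one; (3) `orbitInv_orbit`: the invariant is constant on `T(𝔸) γ T′(𝔸)`, in particular on the rational double cosets
`T(k) γ T′(k)`; (4) `orbitInv_sub_mem_congrSet_of_mem_levelK`: for `κ, κ' ∈ K(N)`, finite-integral `γ₀` and
finite-integral `g`, `orbitInv (κ γ₀ κ') ≡ orbitInv γ₀ (mod N)` (BlockDetCongruence) — an ADELIC statement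
(`κ γ₀ κ'` is not rational: `K(N)` has archimedean component `1`, LevelKVacuity); (5) `orbitInvK` — the same
polynomial on `k`-matrices — with `orbitInv_eq_algebraMap` (rational points).  The rational form of the
congruence is stated on FINITE PARTS in OrbitInvariantFinite (`ofFinPart γ ∈ K(N) · ofFinPart γ₀ · K(N)`).

Together with OrbitalSupport / ArchDistLower this is (S1)'s congruence THROUGH the finite torus parts: the orbit
invariant of a representative `γ` with `t⁻¹ γ t' ∈ K(N) γ₀ K(N)` (finite places) is congruent to `orbitInv γ₀`
modulo `N` — `orbitInv (t⁻¹ γ t') = orbitInv γ` by (3) for adelic torus points.  No printed input.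
HC_CM is NOT proved by anyone in this repository.
-/

namespace Summit.Ventures.HodgeRepro.Tier4.Line4

open Summit.Ventures.HodgeRepro.Tier4.Common NumberField Matrix
open scoped NumberField

noncomputable section

/-! ## Block algebra over a commutative ring -/

section Blocks

variable {R : Type} [CommRing R]

/-- The top-left `2×2` block of a `4×4` matrix (rows and columns `0, 1`). -/
def blockTL (M : Matrix (Fin 4) (Fin 4) R) : Matrix (Fin 2) (Fin 2) R :=
  Matrix.toBlocks₁₁ ((re4R (R := R)).symm M)

/-- The block of a block-diagonal matrix. -/
theorem blockTL_blockDiag4R (A D : Matrix (Fin 2) (Fin 2) R) : blockTL (blockDiag4R A D) = A := by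
  unfold blockTL blockDiag4R
  rw [AlgEquiv.symm_apply_apply, Matrix.toBlocks_fromBlocks₁₁]

/-- Left multiplication by a block-diagonal matrix acts on the top-left block by its first block. -/
theorem blockTL_blockDiag4R_mul (A D : Matrix (Fin 2) (Fin 2) R) (M : Matrix (Fin 4) (Fin 4) R) :
    blockTL (blockDiag4R A D * M) = A * blockTL M := by
  unfold blockTL blockDiag4R
  rw [map_mul, AlgEquiv.symm_apply_apply]
  ext i j
  simp only [Matrix.toBlocks₁₁, Matrix.of_apply, Matrix.mul_apply, Fintype.sum_sum_type,
    Matrix.fromBlocks_apply₁₁, Matrix.fromBlocks_apply₁₂, Matrix.zero_apply, zero_mul,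
    Finset.sum_const_zero, add_zero]

/-- Right multiplication by a block-diagonal matrix acts on the top-left block by its first block. -/
theorem blockTL_mul_blockDiag4R (M : Matrix (Fin 4) (Fin 4) R) (A D : Matrix (Fin 2) (Fin 2) R) :
    blockTL (M * blockDiag4R A D) = blockTL M * A := by
  unfold blockTL blockDiag4R
  rw [map_mul, AlgEquiv.symm_apply_apply]
  ext i j
  simp only [Matrix.toBlocks₁₁, Matrix.of_apply, Matrix.mul_apply, Fintype.sum_sum_type,
    Matrix.fromBlocks_apply₁₁, Matrix.fromBlocks_apply₂₁, Matrix.zero_apply, mul_zero,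
    Finset.sum_const_zero, add_zero]

/-- The top-left block, entrywise: rows and columns `0, 1` of `M`. -/
theorem blockTL_apply (M : Matrix (Fin 4) (Fin 4) R) (i j : Fin 2) :
    blockTL M i j = M (Fin.castAdd 2 i) (Fin.castAdd 2 j) := by
  simp only [blockTL, re4R, Matrix.toBlocks₁₁, Matrix.of_apply,
    Matrix.symm_reindexAlgEquiv, Matrix.coe_reindexAlgEquiv, Matrix.reindex_apply,
    Matrix.submatrix_apply, Equiv.symm_symm]
  rfl

/-- The determinant of the top-left block is the `(0 1) × (0 1)` block determinant of BlockDetCongruence. -/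
theorem det_blockTL (M : Matrix (Fin 4) (Fin 4) R) :
    (blockTL M).det = M 0 0 * M 1 1 - M 0 1 * M 1 0 := by
  rw [Matrix.det_fin_two]
  simp only [blockTL_apply]
  rfl

/-- The determinant of the block of `x + y ω` is the norm form `x² + t x y + n y²`. -/
theorem det_blockOf (t n x y : R) : (blockOf t n x y).det = x ^ 2 + t * x * y + n * y ^ 2 := by
  simp only [blockOf, omegaMatR, Matrix.det_fin_two, Matrix.add_apply, Matrix.smul_apply,
    Matrix.one_apply, Matrix.of_apply, Matrix.cons_val', Matrix.cons_val_zero, Matrix.cons_val_one,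
    Matrix.empty_val', Matrix.cons_val_fin_one, smul_eq_mul]
  simp only [Fin.isValue, one_ne_zero, ↓reduceIte, zero_ne_one, mul_one, mul_zero, add_zero, zero_add,
    mul_neg]
  ring

end Blocks

/-! ## The invariant -/

section Invariant

variable {k : Type} [Field k] [NumberField k] (W : PlaneData k) (g : Matrix (Fin 4) (Fin 4) k)

/-- **THE ORBIT INVARIANT**: the determinant (= `E′/k`-norm) of the top-left `2×2` block of `γ g`. -/
def orbitInv (γ : GA W) : Ad k := (blockTL (GA.mat W γ * adMat k g)).det

/-- The invariant as the `(0 1) × (0 1)` block determinant of `γ g`. -/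
theorem orbitInv_eq_blockDet (γ : GA W) :
    orbitInv W g γ = blockDet (GA.mat W γ * adMat k g) 0 1 0 1 := by
  unfold orbitInv blockDet
  exact det_blockTL _

/-- The same polynomial on `k`-matrices. -/
def orbitInvK (m : Matrix (Fin 4) (Fin 4) k) : k := (blockTL (m * g)).det

/-- On a rational point the invariant is the principal adele of `orbitInvK` of its `k`-matrix. -/
theorem orbitInv_eq_algebraMap {γ : GA W} {m : Matrix (Fin 4) (Fin 4) k}
    (hm : GA.mat W γ = m.map (algebraMap k (Ad k))) :
    orbitInv W g γ = algebraMap k (Ad k) (orbitInvK g m) := by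
  rw [orbitInv_eq_blockDet, orbitInvK, det_blockTL, hm, adMat, ← Matrix.map_mul,
    blockDet_map_algebraMap]

end Invariant

/-! ## Invariance under the two tori (seesaw shape) -/

section Seesaw

variable {k : Type} [Field k] [NumberField k] (q : QuadData k) (a b ε a' b' ε' : k)
  (g g' : Matrix (Fin 4) (Fin 4) k) (hgg' : g * g' = 1) (hg'g : g' * g = 1)
  (hgΩ : g * (PlaneData.ofLinesRow q a b ε).Ω = (PlaneData.ofLinesRow q a b ε).Ω * g)

/-- `adMat` of a scalar multiple. -/
theorem adMat_smul_eq (c : k) (A : Matrix (Fin 4) (Fin 4) k) :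
    adMat k (c • A) = algebraMap k (Ad k) c • adMat k A := by
  unfold adMat
  ext i j
  simp only [Matrix.map_apply, Matrix.smul_apply, smul_eq_mul, map_mul]

/-- The top-left block of a torus element has norm one (determinant `1`). -/
theorem det_blockTL_mat_of_mem_torusT (ha : a ≠ 0) (hb : b ≠ 0) (hε : ε ≠ 0)
    (τ : GA (PlaneData.ofLinesRow q a b ε)) (hτ : τ ∈ torusT (PlaneData.ofLinesRow q a b ε)) :
    (blockTL (GA.mat (PlaneData.ofLinesRow q a b ε) τ)).det = 1 := by
  obtain ⟨x₀, y₀, x₁, y₁, hmat, h₀, _⟩ := exists_block_of_mem_torusT_ofLinesRow q a b ε ha hb hε τ hτ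
  rw [hmat, blockTL_blockDiag4R]
  have := det_blockOf (algebraMap k (Ad k) q.t) (algebraMap k (Ad k) q.n) x₀ y₀
  unfold blockOf at this
  rw [this]
  exact h₀

/-- **(1) Left invariance under `T`** on the transported plane (`torusT` is unchanged by the transport). -/
theorem orbitInv_torusT_mul (ha : a ≠ 0) (hb : b ≠ 0) (hε : ε ≠ 0)
    (τ γ : GA ((PlaneData.ofLinesRow q a b ε).withTransportedTorus g g' hgg' hg'g hgΩ))
    (hτ : τ ∈ torusT ((PlaneData.ofLinesRow q a b ε).withTransportedTorus g g' hgg' hg'g hgΩ)) :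
    orbitInv _ g (τ * γ) = orbitInv _ g γ := by
  have hdet : (blockTL (GA.mat _ τ)).det = 1 :=
    det_blockTL_mat_of_mem_torusT q a b ε ha hb hε τ hτ
  obtain ⟨x₀, y₀, x₁, y₁, hmat, -, -⟩ := exists_block_of_mem_torusT_ofLinesRow q a b ε ha hb hε τ hτ
  unfold orbitInv
  rw [GA.mat_mul, Matrix.mul_assoc]
  change (blockTL (GA.mat (PlaneData.ofLinesRow q a b ε) τ * _)).det = _
  rw [hmat, blockTL_blockDiag4R_mul, Matrix.det_mul]
  rw [hmat, blockTL_blockDiag4R] at hdet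
  rw [hdet, one_mul]

omit [NumberField k] in
/-- The projectors of the two row planes coincide (they do not depend on the Gram data). -/
theorem ofLinesRow_P_eq : (PlaneData.ofLinesRow q a' b' ε').P = (PlaneData.ofLinesRow q a b ε).P := rfl

omit [NumberField k] in
/-- The multiplication matrices of the two row planes coincide. -/
theorem ofLinesRow_Ω_eq : (PlaneData.ofLinesRow q a' b' ε').Ω = (PlaneData.ofLinesRow q a b ε).Ω := rfl

omit [NumberField k] in
include hgg' hg'g hgΩ in
/-- `g'` commutes with `Ω` as well. -/
theorem g'_comm_Ω : g' * (PlaneData.ofLinesRow q a b ε).Ω = (PlaneData.ofLinesRow q a b ε).Ω * g' := by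
  calc g' * (PlaneData.ofLinesRow q a b ε).Ω
      = g' * (PlaneData.ofLinesRow q a b ε).Ω * (g * g') := by rw [hgg', Matrix.mul_one]
    _ = g' * ((PlaneData.ofLinesRow q a b ε).Ω * g) * g' := by simp only [Matrix.mul_assoc]
    _ = g' * (g * (PlaneData.ofLinesRow q a b ε).Ω) * g' := by rw [hgΩ]
    _ = (PlaneData.ofLinesRow q a b ε).Ω * g' := by rw [← Matrix.mul_assoc, hg'g, Matrix.one_mul]

omit [NumberField k] in
include hgg' hg'g in
/-- The Gram matrix of the source plane from the similitude: `B′ = λ • g' B g'ᵀ`. -/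
theorem B'_eq_of_similitude (lam : k)
    (hiso : g * (PlaneData.ofLinesRow q a' b' ε').B * gᵀ = lam • (PlaneData.ofLinesRow q a b ε).B) :
    (PlaneData.ofLinesRow q a' b' ε').B = lam • (g' * (PlaneData.ofLinesRow q a b ε).B * g'ᵀ) := by
  have h1 : g'ᵀ * gᵀ = 1 := by rw [← Matrix.transpose_mul, hgg', Matrix.transpose_one]
  have h2 : gᵀ * g'ᵀ = 1 := by rw [← Matrix.transpose_mul, hg'g, Matrix.transpose_one]
  calc (PlaneData.ofLinesRow q a' b' ε').B
      = (g' * g) * (PlaneData.ofLinesRow q a' b' ε').B * (gᵀ * g'ᵀ) := by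
        rw [hg'g, h2, Matrix.one_mul, Matrix.mul_one]
    _ = g' * (g * (PlaneData.ofLinesRow q a' b' ε').B * gᵀ) * g'ᵀ := by simp only [Matrix.mul_assoc]
    _ = g' * (lam • (PlaneData.ofLinesRow q a b ε).B) * g'ᵀ := by rw [hiso]
    _ = lam • (g' * (PlaneData.ofLinesRow q a b ε).B * g'ᵀ) := by
        rw [Matrix.mul_smul, Matrix.smul_mul]

/-- **The conjugate `σ = g' τ′ g` of an element of the transported torus `T′` lies in the torus of the source plane
`U′` when `g` is a similitude `g B′ gᵀ = λ B`.** -/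
theorem exists_mem_torusT_conj (lam : k)
    (hiso : g * (PlaneData.ofLinesRow q a' b' ε').B * gᵀ = lam • (PlaneData.ofLinesRow q a b ε).B)
    (τ' : GA ((PlaneData.ofLinesRow q a b ε).withTransportedTorus g g' hgg' hg'g hgΩ))
    (hτ' : τ' ∈ torusT' ((PlaneData.ofLinesRow q a b ε).withTransportedTorus g g' hgg' hg'g hgΩ)) :
    ∃ σ : GA (PlaneData.ofLinesRow q a' b' ε'), σ ∈ torusT (PlaneData.ofLinesRow q a' b' ε') ∧
      GA.mat (PlaneData.ofLinesRow q a' b' ε') σ = adMat k g' * GA.mat _ τ' * adMat k g := by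
  -- abbreviations
  set T := GA.mat ((PlaneData.ofLinesRow q a b ε).withTransportedTorus g g' hgg' hg'g hgΩ) τ' with hT
  set Ti := GA.mat ((PlaneData.ofLinesRow q a b ε).withTransportedTorus g g' hgg' hg'g hgΩ) τ'⁻¹ with hTi
  have hgg'A : adMat k g * adMat k g' = 1 := by rw [← adMat_mul, hgg', adMat_one]
  have hg'gA : adMat k g' * adMat k g = 1 := by rw [← adMat_mul, hg'g, adMat_one]
  have hTTi : T * Ti = 1 := GA.mat_mul_inv _ τ'
  have hTiT : Ti * T = 1 := GA.mat_inv_mul _ τ'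
  -- the unit
  let σu : GL4 k :=
    { val := adMat k g' * T * adMat k g
      inv := adMat k g' * Ti * adMat k g
      val_inv := by
        calc adMat k g' * T * adMat k g * (adMat k g' * Ti * adMat k g)
            = adMat k g' * T * (adMat k g * adMat k g') * Ti * adMat k g := by simp only [Matrix.mul_assoc]
          _ = adMat k g' * (T * Ti) * adMat k g := by rw [hgg'A, Matrix.mul_one]; simp only [Matrix.mul_assoc]
          _ = 1 := by rw [hTTi, Matrix.mul_one, hg'gA]
      inv_val := by
        calc adMat k g' * Ti * adMat k g * (adMat k g' * T * adMat k g)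
            = adMat k g' * Ti * (adMat k g * adMat k g') * T * adMat k g := by simp only [Matrix.mul_assoc]
          _ = adMat k g' * (Ti * T) * adMat k g := by rw [hgg'A, Matrix.mul_one]; simp only [Matrix.mul_assoc]
          _ = 1 := by rw [hTiT, Matrix.mul_one, hg'gA] }
  -- unitarity of τ' on W (B, Ω of the transported plane are those of the base plane)
  have hτΩ : T * adMat k (PlaneData.ofLinesRow q a b ε).Ω = adMat k (PlaneData.ofLinesRow q a b ε).Ω * T := τ'.2.1
  have hτB : T * adMat k (PlaneData.ofLinesRow q a b ε).B * Tᵀ = adMat k (PlaneData.ofLinesRow q a b ε).B := τ'.2.2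
  have hgΩA : adMat k g * adMat k (PlaneData.ofLinesRow q a b ε).Ω =
      adMat k (PlaneData.ofLinesRow q a b ε).Ω * adMat k g := by rw [← adMat_mul, hgΩ, adMat_mul]
  have hg'ΩA : adMat k g' * adMat k (PlaneData.ofLinesRow q a b ε).Ω =
      adMat k (PlaneData.ofLinesRow q a b ε).Ω * adMat k g' := by
    rw [← adMat_mul, g'_comm_Ω q a b ε g g' hgg' hg'g hgΩ, adMat_mul]
  have hB' := B'_eq_of_similitude q a b ε a' b' ε' g g' hgg' hg'g lam hiso
  -- σ ∈ unitaryGroup U'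
  have hσmem : σu ∈ unitaryGroup (PlaneData.ofLinesRow q a' b' ε') := by
    refine ⟨?_, ?_⟩
    · show adMat k g' * T * adMat k g * adMat k (PlaneData.ofLinesRow q a' b' ε').Ω =
        adMat k (PlaneData.ofLinesRow q a' b' ε').Ω * (adMat k g' * T * adMat k g)
      rw [ofLinesRow_Ω_eq]
      calc adMat k g' * T * adMat k g * adMat k (PlaneData.ofLinesRow q a b ε).Ω
          = adMat k g' * T * (adMat k g * adMat k (PlaneData.ofLinesRow q a b ε).Ω) := by
            simp only [Matrix.mul_assoc]
        _ = adMat k g' * (T * adMat k (PlaneData.ofLinesRow q a b ε).Ω) * adMat k g := by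
            rw [hgΩA]; simp only [Matrix.mul_assoc]
        _ = (adMat k g' * adMat k (PlaneData.ofLinesRow q a b ε).Ω) * T * adMat k g := by
            rw [hτΩ]; simp only [Matrix.mul_assoc]
        _ = adMat k (PlaneData.ofLinesRow q a b ε).Ω * (adMat k g' * T * adMat k g) := by
            rw [hg'ΩA]; simp only [Matrix.mul_assoc]
    · show adMat k g' * T * adMat k g * adMat k (PlaneData.ofLinesRow q a' b' ε').B *
          (adMat k g' * T * adMat k g)ᵀ = adMat k (PlaneData.ofLinesRow q a' b' ε').B
      rw [hB', adMat_smul_eq, adMat_mul, adMat_mul, adMat_transpose]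
      have hgg'T : (adMat k g)ᵀ * (adMat k g')ᵀ = 1 := by
        rw [← Matrix.transpose_mul, hg'gA, Matrix.transpose_one]
      simp only [Matrix.transpose_mul, Matrix.mul_smul, Matrix.smul_mul]
      congr 1
      calc adMat k g' * T * adMat k g * (adMat k g' * adMat k (PlaneData.ofLinesRow q a b ε).B * (adMat k g')ᵀ) *
            ((adMat k g)ᵀ * (Tᵀ * (adMat k g')ᵀ))
          = adMat k g' * T * (adMat k g * adMat k g') * adMat k (PlaneData.ofLinesRow q a b ε).B *
            ((adMat k g')ᵀ * (adMat k g)ᵀ) * Tᵀ * (adMat k g')ᵀ := by simp only [Matrix.mul_assoc]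
        _ = adMat k g' * (T * adMat k (PlaneData.ofLinesRow q a b ε).B * Tᵀ) * (adMat k g')ᵀ := by
            rw [hgg'A, Matrix.mul_one, ← Matrix.transpose_mul, hgg'A, Matrix.transpose_one, Matrix.mul_one]
            simp only [Matrix.mul_assoc]
        _ = adMat k g' * adMat k (PlaneData.ofLinesRow q a b ε).B * (adMat k g')ᵀ := by
            rw [hτB]
  refine ⟨⟨σu, hσmem⟩, ?_, rfl⟩
  -- σ commutes with the projectors
  have hcomm : ∀ i : Fin 2, (adMat k g' * T * adMat k g) * adMat k ((PlaneData.ofLinesRow q a' b' ε').P i) =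
      adMat k ((PlaneData.ofLinesRow q a' b' ε').P i) * (adMat k g' * T * adMat k g) := by
    intro i
    have hQ : T * adMat k (g * (PlaneData.ofLinesRow q a b ε).P i * g') =
        adMat k (g * (PlaneData.ofLinesRow q a b ε).P i * g') * T := by
      rcases hτ' with ⟨h0, h1⟩
      fin_cases i
      · exact h0
      · exact h1
    rw [adMat_mul, adMat_mul] at hQ
    rw [ofLinesRow_P_eq]
    calc adMat k g' * T * adMat k g * adMat k ((PlaneData.ofLinesRow q a b ε).P i)
        = adMat k g' * T * adMat k g * adMat k ((PlaneData.ofLinesRow q a b ε).P i) * (adMat k g' * adMat k g) := by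
          rw [hg'gA, Matrix.mul_one]
      _ = adMat k g' * (T * (adMat k g * adMat k ((PlaneData.ofLinesRow q a b ε).P i) * adMat k g')) * adMat k g := by
          simp only [Matrix.mul_assoc]
      _ = adMat k g' * (adMat k g * adMat k ((PlaneData.ofLinesRow q a b ε).P i) * adMat k g' * T) * adMat k g := by
          rw [hQ]
      _ = (adMat k g' * adMat k g) * adMat k ((PlaneData.ofLinesRow q a b ε).P i) * (adMat k g' * T * adMat k g) := by
          simp only [Matrix.mul_assoc]
      _ = adMat k ((PlaneData.ofLinesRow q a b ε).P i) * (adMat k g' * T * adMat k g) := by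
          rw [hg'gA, Matrix.one_mul]
  exact ⟨hcomm 0, hcomm 1⟩

/-- **(2) Right invariance under `T′`** on the transported plane, for a similitude `g`. -/
theorem orbitInv_mul_torusT' (ha' : a' ≠ 0) (hb' : b' ≠ 0) (hε' : ε' ≠ 0) (lam : k)
    (hiso : g * (PlaneData.ofLinesRow q a' b' ε').B * gᵀ = lam • (PlaneData.ofLinesRow q a b ε).B)
    (γ τ' : GA ((PlaneData.ofLinesRow q a b ε).withTransportedTorus g g' hgg' hg'g hgΩ))
    (hτ' : τ' ∈ torusT' ((PlaneData.ofLinesRow q a b ε).withTransportedTorus g g' hgg' hg'g hgΩ)) :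
    orbitInv _ g (γ * τ') = orbitInv _ g γ := by
  obtain ⟨σ, hσ, hσmat⟩ :=
    exists_mem_torusT_conj q a b ε a' b' ε' g g' hgg' hg'g hgΩ lam hiso τ' hτ'
  have hdet : (blockTL (GA.mat (PlaneData.ofLinesRow q a' b' ε') σ)).det = 1 :=
    det_blockTL_mat_of_mem_torusT q a' b' ε' ha' hb' hε' σ hσ
  obtain ⟨x₀, y₀, x₁, y₁, hmat, -, -⟩ := exists_block_of_mem_torusT_ofLinesRow q a' b' ε' ha' hb' hε' σ hσ
  have hgg'A : adMat k g * adMat k g' = 1 := by rw [← adMat_mul, hgg', adMat_one]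
  have key : GA.mat _ τ' * adMat k g = adMat k g * GA.mat (PlaneData.ofLinesRow q a' b' ε') σ := by
    rw [hσmat]
    calc GA.mat _ τ' * adMat k g
        = (adMat k g * adMat k g') * GA.mat _ τ' * adMat k g := by rw [hgg'A, Matrix.one_mul]
      _ = adMat k g * (adMat k g' * GA.mat _ τ' * adMat k g) := by simp only [Matrix.mul_assoc]
  unfold orbitInv
  rw [GA.mat_mul, Matrix.mul_assoc, key, ← Matrix.mul_assoc, hmat, blockTL_mul_blockDiag4R, Matrix.det_mul]
  rw [hmat, blockTL_blockDiag4R] at hdet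
  rw [hdet, mul_one]

/-- **(3) The invariant is constant on the double cosets `T(𝔸) γ T′(𝔸)`** — in particular on the rational double
cosets `T(k) γ T′(k)`, i.e. on the orbits of the relative trace formula. -/
theorem orbitInv_orbit (ha : a ≠ 0) (hb : b ≠ 0) (hε : ε ≠ 0) (ha' : a' ≠ 0) (hb' : b' ≠ 0) (hε' : ε' ≠ 0)
    (lam : k)
    (hiso : g * (PlaneData.ofLinesRow q a' b' ε').B * gᵀ = lam • (PlaneData.ofLinesRow q a b ε).B)
    (τ γ τ' : GA ((PlaneData.ofLinesRow q a b ε).withTransportedTorus g g' hgg' hg'g hgΩ))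
    (hτ : τ ∈ torusT ((PlaneData.ofLinesRow q a b ε).withTransportedTorus g g' hgg' hg'g hgΩ))
    (hτ' : τ' ∈ torusT' ((PlaneData.ofLinesRow q a b ε).withTransportedTorus g g' hgg' hg'g hgΩ)) :
    orbitInv _ g (τ * γ * τ') = orbitInv _ g γ := by
  rw [orbitInv_mul_torusT' q a b ε a' b' ε' g g' hgg' hg'g hgΩ ha' hb' hε' lam hiso (τ * γ) τ' hτ',
    orbitInv_torusT_mul q a b ε g g' hgg' hg'g hgΩ ha hb hε τ γ hτ]

end Seesaw

/-! ## The level congruence and the rational form -/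

section Congruence

variable {k : Type} [Field k] [NumberField k] (W : PlaneData k) (g : Matrix (Fin 4) (Fin 4) k)

/-- The matrix `γ g` of a finite-integral `γ` is finite-integral when `g` is. -/
theorem isIntegralFinMat_mul_adMat (hg : IsIntegralFinMat (adMat k g)) {γ : GA W} (hγ : IsIntegralFin W γ) :
    IsIntegralFinMat (GA.mat W γ * adMat k g) :=
  hγ.mul hg

/-- **(4) The invariant passes the level congruence**: for `κ, κ' ∈ K(N)`, finite-integral `γ₀` and finite-integral
`g`, `orbitInv (κ γ₀ κ') ≡ orbitInv γ₀ (mod N)`. -/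
theorem orbitInv_sub_mem_congrSet_of_mem_levelK {N : ℕ} (hg : IsIntegralFinMat (adMat k g)) {κ κ' γ₀ : GA W}
    (hκ : κ ∈ levelK W N) (hκ' : κ' ∈ levelK W N) (hγ₀ : IsIntegralFin W γ₀) :
    orbitInv W g (κ * γ₀ * κ') - orbitInv W g γ₀ ∈ congrSet k N := by
  rw [orbitInv_eq_blockDet, orbitInv_eq_blockDet]
  refine blockDet_sub_mem_congrSet (isIntegralFinMat_mul_adMat W g hg (isIntegralFin_mul_of_mem_levelK W hκ hκ' hγ₀))
    (isIntegralFinMat_mul_adMat W g hg hγ₀) (fun i j => ?_) 0 1 0 1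
  rw [← Matrix.sub_mul, Matrix.mul_apply]
  refine sum_mem_congrSet k _ fun l _ => ?_
  exact mul_mem_congrSet_of_integral k (mat_sub_mem_congrSet_of_mem_levelK W hκ hκ' hγ₀ i l) (hg l j)

end Congruence

end

end Summit.Ventures.HodgeRepro.Tier4.Line4
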